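import Mathlib
import HarnessLib
import HarnessLib.Audit
import Summits.CriticalPhenomena.Statement
import Literature.Probability.LatticeModels.IsingModel
import Literature.Probability.LatticeModels.ScalingLimit3D
import HarnessLib.Audit.Status.Attr

/-!
Route: VolterraWard

DORMANT since 2026-08-29T19:34:16Z (census g0: costume|duplicate of route-CriticalPhenomena-HyperoctahedralRP; reader census-reader-36-g0) — unstaffed, not closed; items shared with open routes are served there. `ledger route dormant <id> --off` reactivates.

# Route VolterraWard — Volterra–Ward — the rotation Ward identity of the critical ℤ³ Ising limit
from twist-wall (screw-dislocation) surgery; insertion-free ε-rotated slabs are invisible at O(ε)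

Route VolterraWard realises idea card volterra-twist-boundary-ward (after repairing the two
construction errors found in the
novelty audit and in this planner's re-derivation, see Why this line). It suffices to show X_VW :=
(INV) ∧ (KIN) ∧ (DECAY) ∧ (CONT) ∧ (C) ∧ (D) ∧ (E),
with (CORE) isolated as the necessary unproved input of the three lattice statements:
(INV) TwistFluxConservation — on the explicit TWISTED GRAPHS (ℤ³ re-glued across one layer by the
area-preserving brickwork map F,
an ε = M/W rotation realised by a staggered grid of pure screw dislocations of block W = w/δ and
Burgers M = εW) the ε-odd response of the
critical correlators depends, to o(ε), only on WHICH insertions lie above/below the wall: moving the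
wall inside an insertion-free height
interval is invisible (conservation of the angular-momentum flux = "an ε-rotated insertion-free slab
of critical crystal is invisible");
(KIN) WallCrossingContinuity — no O(ε) jump when the wall crosses an insertion height; (DECAY)
WallDecay — far walls: invisible above,
exact transport by F below; (CONT) LimitContinuous — scaling limits are continuous off the
coincident locus; (C) ExistsScaleCovariantLimit,
(D) InversionUpgradeNormalised, (E) IsingEuclidUpgradeR4NonGaussian — the shared Möbius tail of
route HyperoctahedralRP (items 1981, 1982, 0636,
statements copied verbatim so the ledger dedups them). The two support items VolterraGlue
(telescoping over wall heights + a leapfrog chain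
along the discretised rotation field) and AxialRotationToO3 (one lattice axis + hyperoctahedral
symmetry generate O(3)) turn (INV,KIN,DECAY,CONT)
into IsRotationInvariant S for the limit S of (C); then (D),(E) give Möbius covariance and U₄ ≢ 0
exactly as in HyperoctahedralRP's assembly.
Limit order everywhere (quantifier nesting, all uniform on compact K ⊆ NonCoincident): wall height /
h first, then w → 0, then ε → 0, then
δ → 0, then the free box N → ∞ — the REVERSE of the card's order in (ε, w), forced by the audit's
core estimate.
Lean: `Summit.CriticalPhenomena.Ising3DConformalLimit.Theses.VolterraWard.Assembly` i.e.
`CoreTransparency → TwistFluxConservation → WallCrossingContinuity → WallDecay → VolterraGlue →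
AxialRotationToO3 → LimitContinuous → ExistsScaleCovariantLimit → InversionUpgradeNormalised →
IsingEuclidUpgradeR4NonGaussian → Ising3DConformalLimit` (every decl elaborates in the planner's
Sketch.lean, rc 0, no warnings; `assembly_holds` is sorry-free with axioms
propext/Classical.choice/Quot.sound). Constants used (lean search --decl / elaborated):
Literature.Probability.LatticeModels.{Site, box, isingExpect, BoundaryCondition.free, spinAt,
criticalBeta, criticalCorr, latticeApprox, NonCoincident, CorrFamily, HasPointwiseScalingLimit,
IsNondegenerateTwoPoint, IsTranslationInvariant, IsRotationInvariant, IsEuclideanInvariant,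
IsScaleCovariant, IsInversionCovariant, HasNontrivialU4}, SimpleGraph.fromRel,
EuclideanSpace.single, LinearIsometryEquiv, LinearMap.det, Nat.floor, Int.floor (Int `/` = floor
division, checked: (-7)/2 = -4).

## Assembly
Pure logic (sorry-free in Sketch.lean, theorem assembly_holds): take (ρ, Δ, S) from
ExistsScaleCovariantLimit; LimitContinuous gives continuity on
NonCoincident from translation invariance + scale covariance; VolterraGlue applied to
TwistFluxConservation, WallCrossingContinuity, WallDecay gives
invariance under rotations about e₃; AxialRotationToO3 upgrades to IsRotationInvariant S, so
IsEuclideanInvariant S := ⟨transl, rot⟩;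
InversionUpgradeNormalised gives IsInversionCovariant Δ S; IsMoebiusCovariant Δ S := ⟨Euclid, scale,
inversion⟩; IsingEuclidUpgradeR4NonGaussian
gives HasNontrivialU4 S; conclude CritIsing3DConformalLimit = Ising3DConformalLimit.
CoreTransparency is the first antecedent (input crux, not
consumed by the term).

Rationale: WHY THIS LINE. Mechanism (card volterra-twist-boundary-ward): integrated stress-tensor FLUXES are
realised not by a lattice operator (there is none) nor by coupling
derivatives (which drag in the relevant temperature direction: CaraccioloEtAl1988
doi:10.1016/0550-3213(88)90332-x, KadanoffCeva1971, sibling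
card flux-quadrupole-stress-tensor) but by VOLTERRA SURGERY of ℤ³ itself; a twist wall (two
perpendicular screw arrays, Frank's formula θ ≈ b/s,
CaiNix2016 §14.2 eqs. (14.20)–(14.25) and §14.3 (14.31)–(14.32); a single array is a shear wall with
a long-range γ_yz, ibid.) is, at O(ε), ε times
the orbital angular-momentum flux through the plane, whose divergence is the antisymmetric stress
T_[xy]; hence INV ⇔ ∫_(plane) ⟨T_[xy] ∏σ⟩ = 0
off insertion heights ⇔ the rotation Ward identity, while KIN (no contact anomaly: the plane
integral of the T_[xy]×σ OPE is odd under x→−x and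
y→−y, so its lowest term is ∂x∂yσ and P(s) ~ s → 0) and DECAY are theory-independent. Imported
areas: dislocation theory / metallurgy (Volterra,
Frank–Bilby; rotation as a composition of lattice shears), defect CFT (monodromy defects
BilloEtAl2013; crystalline symmetry fluxes
doi:10.1103/physrevx.8.011040; momentum polarization doi:10.1103/physrevb.88.195412), Harris-type
relevance of line defects (doi:10.1080/00018739300101544),
and elementary real analysis for the glue (symmetric derivates + continuity ⇒ constancy). Two errors
of the card are repaired here: (E1) the
card's block map p ↦ p + εw(−k, j) has determinant 1+ε², leaving b×b holes (M² dangling sites, a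
RELEVANT planar patch growing like M^(2−Δ_ε)) at
every grid node — replaced by the area-preserving brickwork bijection F(p) = (p₀ − Mk, p₁ + Mj), k =
⌊p₁/W⌋, j = ⌊(p₀ − Mk)/W⌋, all of whose jump
segments slide (pure screw) with O(ε²)-area jogs; (E2) the audit's CORRECTNESS WARNING (a screw of
Burgers M ≫ 1 is a strong universal-cover line
defect out to radius b = εw; wall achiral strength ε^p (r/w)^(1−p), p = Δ_ε − 1) — met by
antisymmetrising in ε (D = C(M) − C(−M), the mirror
image up to O(ε) brick offsets, achiral residual O(ε^(1+p)(r/w)^(1−p)) = o(ε) at fixed w iff p > 0)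
and by the limit order δ, ε, w, h; the
qualitative input p > 0 is isolated as CoreTransparency. What the line does that prior routes do
not: HyperoctahedralRP gets isotropy from nine
reflection positivities by one-variable analytic rigidity on ONE lattice;
IsingEuclidUpgrade/IsingCFTData assume it; this route compares ℤ³ with
its own surgeries at the same β_c (a Δ-free, fit-free, MC-testable null statement) and explains
structurally why rotations are the cheap third of
clause (ii) (screws conserve matter) while dilations are not reachable by surgery (climb needs
matter, card item V5; Liouville). Negatives index:
only SAW item 0772 — untouched.

RANKED CRUXES. #2 TwistFluxConservation (crux) — (INV, card V3 in single-wall form) For every n,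
every compact K of non-coincident configurations, every insertion-free closed height slab [a, a′]
for K and every η > 0: for w small, then ε small, then δ small, then N large, uniformly in x ∈ K,
the ε-odd twisted free-box response D (twist M minus twist −M, M = ⌊ε⌊w/δ⌋⌋, block ⌊w/δ⌋, free b.c.
on box 3 N at β_c(3)) with the wall at ⌊a/δ⌋ differs from the one with the wall at ⌊a′/δ⌋ by at most
η·ε·⟨∏σ_[xᵢ/δ]⟩⁺_(β_c). The twisted graph: planar n.n. bonds in layers z ≤ A, F-pulled-back planar
bonds in layers z > A, straight vertical bonds (≅ the card's bicrystal glued by F). [deps: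
CoreTransparency] [difficulty: open-problem] (why it might fail: This IS emergent isotropy: an
O_h-symmetric but anisotropic subsequential limit (relevant/marginal spin-4 cubic operator; physics
puts it at Δ≈5.02, irrelevant, nothing rigorous) transmits torque through empty slabs; also dies if
fat-screw achiral remnants are only marginal (ν=1/2).) [CaiNix2016, KadanoffCeva1971,
doi:10.1016/0550-3213(88)90332-x, DuminilCopinICM2022, DKKMO2020Rotational, BilloEtAl2013,
doi:10.1103/physrevx.8.011040, doi:10.1103/physrevb.88.195412]
#3 CoreTransparency (crux) — (CORE, the audit's worry isolated; card V2 corrected from (δ/r)^p to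
(b/r)^p) Zeroth-order transparency of the twist wall as the Burgers LENGTH b = εw → 0 at FIXED block
size w: for every n, compact K, wall height a avoiding the insertion heights of K, every w > 0 and η
> 0: for ε small, then δ small, then N large, uniformly on K, |C(M) + C(−M) − 2⟨∏σ⟩⁺_(β_c)| ≤
η⟨∏σ⟩⁺_(β_c) (the ε-even combination of twisted free-box correlators tends to twice the plain
infinite-volume critical correlator). Equivalent in RG language to strict irrelevance of the achiral
remnant of a fat screw, i.e. Δ_ε > 1. Necessary for INV/KIN/DECAY as stated; not consumed by the
assembly term (diagnostic input crux, listed first in the Assembly). [difficulty: open-problem] (why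
it might fail: Needs STRICT irrelevance of even line defects, Δ_ε>1 ⇔ ν>1/2 strictly (physics
Δ_ε=1.4126; rigorously only ν≥1/2): a fat screw (Burgers M=εw/δ→∞) is a strong universal-cover line
defect out to radius b=εw and the wall carries 2/w of them per unit length.)
[doi:10.1080/00018739300101544, KosPolandSimmonsDuffinVichi2016, FernandezFrohlichSokal1992,
BilloEtAl2013, DuminilcopinPanis2025, CaiNix2016]
#4 WallCrossingContinuity (crux) — (KIN, card V4 in the relabelled convention where insertions keep
their physical positions) For every n, compact K, height t and η > 0 there is h₀ such that for every
h < h₀: for w small, then ε small, then δ small, then N large, uniformly on K, the ε-odd responses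
with the wall at ⌊(t+h)/δ⌋ and at ⌊(t−h)/δ⌋ differ by at most η·ε·⟨∏σ⟩⁺_(β_c): crossing an insertion
height produces no O(ε) jump (the wall's contact term is purely kinematic and, in this convention,
absent). h → 0 is the OUTERMOST limit (h chosen before w). [deps: CoreTransparency] [difficulty: XL]
(why it might fail: The wall's contact term at an insertion must vanish: this uses an OPE-like local
structure in which the plane integral of T_[xy]·σ starts at ∂x∂yσ (odd under both in-plane mirrors);
a lattice-scale wall–spin anomaly at height distance h≫w≫b could survive the limits.) [Cardy1996,
doi:10.1016/0550-3213(88)90332-x, PolandRychkovVichi2019, KadanoffCeva1971,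
KosPolandSimmonsDuffinVichi2016]
#5 WallDecay (crux) — (DECAY, card V4 'cluster property' half, made precise) Conjunction of: (+) for
every n, compact K, η > 0 there is a₀ with: for every wall height a ≥ a₀, for w small, then ε small,
then δ small, then N large, uniformly on K, |D(⌊a/δ⌋)| ≤ η ε ⟨∏σ⟩⁺_(β_c) (a wall far ABOVE
everything is invisible at O(ε)); (−) the same with a ≤ a₀ (far BELOW everything) for |D(⌊a/δ⌋) −
(⟨∏σ_(F_M[xᵢ/δ])⟩⁺_(β_c) − ⟨∏σ_(F_(−M)[xᵢ/δ])⟩⁺_(β_c))|: up to o(ε) the wall acts as the EXACT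
TRANSPORT of the insertions by the brickwork map (graph isomorphism F×id of the pulled-back region
onto ℤ³), the kinematic term, expressed with infinite-volume critical correlators at the transported
sites. [deps: CoreTransparency] [difficulty: L] (why it might fail: (−) is exact transport by the
graph isomorphism F×id plus decay of the far wall's O(ε) torque; both parts fail if the ε-odd
influence of a wall at distance |a| does not vanish as |a|→∞ after ε→0 (long-range chiral memory),
or if free-box limits on twisted graphs misbehave at β_c.) [GeorgiiHiguchi2000, FriedliVelenik2017,
AizenmanDuminilCopinSidoravicius2015, Raoufi2020, CaiNix2016]
#6 ExistsScaleCovariantLimit (crux) — (C) [shared verbatim with HyperoctahedralRP item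
stmt-CriticalPhenomena-1981] there are ρ > 0 on (0,1], Δ > 0 and S with HasPointwiseScalingLimit
(criticalCorr 3) ρ S, S = 0 off NonCoincident, IsNondegenerateTwoPoint S, IsTranslationInvariant S,
IsScaleCovariant Δ S — existence WITHOUT rotations (isotropy is OUTPUT of this route). [difficulty:
open-problem] (why it might fail: Full δ→0⁺ convergence with ONE continuous Δ is open on ℤ³: only
subsequential limits follow from the two-point bounds, and RP/GKS two-point axiomatics admit
log-periodic (discretely scale covariant) profiles (card rp-cannot-fix-the-scale-log-periodic).)
[DuminilCopinICM2022, DuminilcopinPanis2025, arXiv:1912.07973, AizenmanDuminilCopinAnnals2021]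
#7 InversionUpgradeNormalised (crux) — (D) [shared verbatim with HyperoctahedralRP item
stmt-CriticalPhenomena-1982] every normalised, non-degenerate, Euclidean-invariant, scale-covariant
pointwise scaling limit of criticalCorr 3 is inversion covariant with the same Δ (the re-typed (U)
of IsingEuclidUpgrade). [difficulty: open-problem] (why it might fail: Scale + RP + Euclid ⇏ Möbius
in general (free Maxwell d=3; RP descendant witnesses at Δ=7/2); for Ising it fails if the limit
carries a virial current of dimension exactly 2 or lacks a local stress tensor — excluded only by
Monte-Carlo (Δ_V > 5).) [ElshowkNakayamaRychkov2011, Nakayama2015, DelamotteTissierWschebor2016,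
PolandRychkovVichi2019, DuminilCopinICM2022]
#8 IsingEuclidUpgradeR4NonGaussian (crux) — (E) [shared item stmt-CriticalPhenomena-0636] every
non-degenerate pointwise scaling limit of criticalCorr 3 has U₄ ≢ 0. [difficulty: open-problem] (why
it might fail: No proof that U₄ ≢ 0 in d = 3: the double-current intersection probability at
macroscopic separation must stay > 0 as δ → 0; RP long-range models ON ℤ³ (α < 3/2) are Gaussian
(LongRangeTrivialityOnZ3).) [AizenmanDuminilCopinAnnals2021, DuminilCopinICM2022]
#9 VolterraGlue (support) — (GLUE, real analysis + the scaling limit; card V4 'Lean-sized' part,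
made honest) TwistFluxConservation → WallCrossingContinuity → WallDecay → for every ρ > 0 on (0,1]
and every pointwise scaling limit S of criticalCorr 3 that is normalised (S = 0 off NonCoincident)
and continuous on NonCoincident: S is invariant under every linear isometry fixing e₃ =
EuclideanSpace.single 2 1 with determinant 1 (rotations about the lattice axis along which the wall
construction is stacked). Proof plan: telescoping over wall heights (finitely many INV gaps + KIN
crossings, DECAY at both ends, common thresholds since all four statements nest w, ε, δ, N
identically) ⇒ |⟨∏σ_(F_M y)⟩ − ⟨∏σ_(F_(−M) y)⟩| ≤ Cηε⟨∏σ_y⟩ uniformly on K; the EXACT identity F_M ∘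
[·/δ] = [·/δ] ∘ F_cont (F_cont(v) = v + Mδ(−k, j, 0), k = ⌊v₁/(Wδ)⌋, j = ⌊(v₀ − Mδk)/(Wδ)⌋, floor
identity ⌊⌊t⌋/W⌋ = ⌊t/W⌋) turns this into symmetric differences of S along the piecewise-constant
field u_w(v) = w(−⌊v₁/w⌋, ⌊v₀/w⌋, 0) = e₃×v + O(w); a leapfrog chain of ε-steps (discrete Euler flow
of u_w), then ε → 0, w → 0 and continuity of S give S(R_θ x) = S(x) ('upper symmetric derivate ≤ κ
everywhere + continuity ⇒ κ-Lipschitz along the flow', Khintchine/Thomson). [difficulty: M]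
[DuminilCopinICM2022, CaiNix2016, Thomson 1994 Symmetric Properties of Real Functions (Dekker) ch.
1–2]
#9 AxialRotationToO3 (support) — for every ρ > 0 on (0,1] and every normalised pointwise scaling
limit S of criticalCorr 3 continuous on NonCoincident: invariance under the rotations about e₃
(isometries fixing EuclideanSpace.single 2 1 with det 1) implies IsRotationInvariant S. Plan: the
plus state at β_c is invariant under the hyperoctahedral group B₃ of signed coordinate permutations
(automorphism covariance of the Ising specification + box limits, in tree:
IsingAutomorphismCovariance / GeorgiiHiguchi2000) and continuity absorbs the floor-rounding [x/δ]
asymmetry, so S is B₃-invariant on NonCoincident (and 0 elsewhere); B₃ conjugates the e₃-stabiliser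
to the e₁-, e₂-stabilisers, rotations about three axes generate SO(3) (Euler angles) and −1 ∈ B₃
gives O(3). [difficulty: M] [GeorgiiHiguchi2000, FriedliVelenik2017]
#9 LimitContinuous (support) — (CONT) every translation-invariant, scale-covariant pointwise scaling
limit S of criticalCorr 3 (ρ > 0 on (0,1]) has every S n continuous on NonCoincident 3 n. Engines:
the axis-direction spectral representation / gradient estimate for the critical two-point function
(DuminilcopinPanis2025, arXiv:2404.05700) and Messager–Miracle-Solé monotonicity give n = 2 (cf.
HyperoctahedralRP's TwoPointKernelOfLimit); n ≥ 3 via RP Cauchy–Schwarz transfer (card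
mirror-hoelder-modulus) or a lattice gradient estimate for n-point functions. Needed by
VolterraGlue/AxialRotationToO3 only through ContinuousOn. [difficulty: L] [DuminilcopinPanis2025,
arXiv:2404.05700, arXiv:1912.07973, MessagerMiracleSoleJSP1977]

TWO-LAYER PLAN. Foreseen glued splits (nothing filed now): TwistFluxConservation ⇐ (INV-a) the EXACT
coupling-interpolation formula for the wall response —
d/dJ along the path from the plain to the twisted wiring writes D(A) − D(A′) as a sum over the
rewired bonds of the one-layer slab (A, A′] of truncated
bond-energy/spin correlations ⟨σ_y ; σ_p σ_(F p)⟩_t in interpolated ferromagnets (lattice form of ∫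
u·T; random-current source-to-edge
connectivities) → (INV-b) the slab sum is o(ε) (the isotropy content) → TwistFluxConservation.
WallDecay ⇐ (transport identity, provable now:
the pulled-back region is graph-isomorphic to ℤ³ via F×id, so free-box twisted correlators equal
card-convention correlators at F-images) →
(far-wall ε-odd influence → 0) → WallDecay. CoreTransparency ⇐ (single fat screw: achiral influence
≤ C(b/r)^p) → (superposition over the
brickwork at fixed w) → CoreTransparency.

KILL CRITERIA. Refutation of TwistFluxConservation (an a-dependence of the ε-odd response at O(ε)
surviving w → 0 — by certified free-fermion/GFF-type
computation transplanted to an admissible anisotropic model, by MC, or by exhibiting an admissible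
anisotropic subsequential limit) closes the route
(close --reason refuted:TwistFluxConservation) and is itself a statement about anisotropy of the ℤ³
limit. Refutation of CoreTransparency (achiral
remnant of fat screws not vanishing as b → 0 at fixed w, e.g. ν = 1/2 exactly or an m-growing core
amplitude) kills the engine for all three lattice
cruxes as stated: close, census to the card. Refutation of WallCrossingContinuity alone forces a
pivot to the kinematic convention (restate KIN with
the explicit transported jump, same glue). Refutation of WallDecay(+) (long-range chiral memory)
closes the route; WallDecay(−)'s transport half is an
isomorphism and cannot fail. (C), (D), (E) are shared with HyperoctahedralRP / IsingEuclidUpgrade /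
IsingCFTData: their refutation kills the
conjunct or all routes alike, not this line specifically. If HyperoctahedralRP's
LimitRotationInvariant closes first, this route's rotation cruxes
become a second, independent proof target (keep open at low priority) — not moot, since INV is a
lattice statement of independent interest.

NOT DECOMPOSED YET. The coupling-interpolation identity behind INV (layer-2 child INV-a above); the
single-screw core estimate behind CORE; the n-point OS/RP
machinery or gradient estimates behind LimitContinuous; the free-box → plus-state identification at
β_c on twisted graphs (GKS monotone limits +
ADS2015/Raoufi uniqueness, used inside WallDecay(−) and the glue); diagonal cut planes / other axes
(not needed: one axis + B₃ suffices); the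
slab (two-wall) form of INV and its additivity with single walls (equivalent at O(ε), not filed);
any shear-wall statement (a single screw array
measures ∫T_xy, CaiNix2016 §14.2.1 — visible in every theory, so not a null test; recorded, not
filed); dilation/special-conformal charges
(unreachable by surgery: climb needs matter, card V5 — the inversion stays the shared item (D)).

CHEAPEST FALSIFIER. (1) FREE-FIELD CALIBRATION at zero cost: the discrete Gaussian free field on the
SAME twisted free boxes is a sparse linear solve; its scaling
limit is isotropic, so INV, KIN, DECAY must hold for it — any O(ε) wall-height dependence of the odd
two-point response surviving w → 0 in the GFF
exposes a kinematic artefact of the surgery/dictionary (brickwork offsets, jogs, relabelling) and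
retires the line before any Ising work; the
same solve shows the universal-cover core (⟨φ²⟩ depletion ∝ 1/ρ for δ ≪ ρ ≪ b) and calibrates CORE
(marginal for the GFF, Δ_φ² = 1, so only a
calibration, not a test). (2) Worm/cluster MC of the critical Ising model on the twisted box (L =
64–128, W = 16–32, M = 1…4): the even response
vs M at fixed W tests CoreTransparency directly (the audit's 'worm-MC check of the local energy near
a screw core vs m'); the odd response of
⟨s_y s_z⟩ (y above, z below) as the wall height sweeps between them tests INV (predicted flat to
O(w)·ε). Neither was run in this plancard session
(no kit job; one-shot planning unit) — refuters should run (1) first.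

NUMBERS. Δ_σ = 0.5181489(10), Δ_ε = 1.412625(10) (KosPolandSimmonsDuffinVichi2016), so p = Δ_ε − 1 =
0.4126 and ν = 1/(3 − Δ_ε) = 0.62997; rigorous
window on ℤ³: c‖x‖⁻² ≤ ⟨σ₀σ_x⟩_(β_c) ≤ C‖x‖⁻¹ (criticalTwoPoint_bounds, in tree), ν ≥ 1/2
heuristically from γ ≥ 1 and χ ≤ Cξ²
(FernandezFrohlichSokal1992); lowest ℤ₂-even spin-4 operator (cubic anisotropy) Δ ≈ 5.02 > 3,
irrelevant by ≈ 2 (bootstrap, arXiv:1612.08471).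
Frank: misorientation θ ≈ b/s for screw spacing s (CaiNix2016 eq. (14.25)); here s = w, b = εw. Wall
achiral strength at scale r: ε^p (r/w)^(1−p)
(→ 0 as ε → 0 at fixed w iff p > 0; diverges in the card's order w → 0 first); antisymmetrised
residual O(ε^(1+p)(r/w)^(1−p)); brick-offset /
Riemann-sum error O(εw); jog area fraction O(ε²).

DEFINITION REQUESTS. To be filed right after open as definition items under
Summits/CriticalPhenomena/Ising3DConformalLimit/Theorems (new objects posited for this
problem), so that a tenure pass can restate the four lattice cruxes over named definitions without
changing their meaning: `brickworkMap W M :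
Site 3 → Site 3` (the F above), `twistGraph N W M A : SimpleGraph ↥(box 3 N)` (the bond predicate
above) and `twistCorr N W M A n y : ℝ` (the C above, =
isingExpect on twistGraph at β_c(3), h = 0, free b.c., of the spin monomial; definition files must
import nothing heavier than
IsingModel / IsingThermodynamics so that the Theses cone stays inside the summit base cone — NOT
GaussianPairingBoundCouplings, whose
PairIsing.avg spelling the 2026-08-15 cone repair removed), `twistOddResponse` (the D above).
Cite-facts wanted (kind cite, family crit-ising): free = plus state at
β_c(3) (AizenmanDuminilCopinSidoravicius2015 + Raoufi2020), and 'even line defects are irrelevant at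
the 3D Ising point iff ν > 1/2'
(doi:10.1080/00018739300101544 §§2–3, physics-level). Bib entries for doi:10.1080/00018739300101544
(IgloiPeschelTurban1993),
doi:10.1103/physrevx.8.011040 (ThorngrenElse2018), doi:10.1016/0550-3213(88)90332-x
(CaraccioloEtAl1988), doi:10.1103/physrevb.88.195412
(TuZhangQi2013) are prepared in the planner folder (refs.bib); `ledger bib add` timed out twice this
session, so the DOIs are cited inline.

Novelty: Searches (2026-08-15, this planner): `lit search --hybrid "twist grain boundary screw dislocation
network Frank formula low-angle"` (10 book hits; read
CaiNix2016 ch. 14 pp. 455–475: §14.2 twist boundary = two screw arrays, single array = long-range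
shear; §14.3 Frank–Bilby), `lit galaxy search
"dislocation Ward identity" --star all` (0 hits in panama/pdf/crabby), `lit galaxy search "twist
defect" --star pdf` (15 hits, all Floquet-code /
biopolymer 'twist defects', none lattice-critical), `lit search` crossref for Iglói–Peschel–Turban
1993 (doi:10.1080/00018739300101544), `ledger
negatives --problem CriticalPhenomena` (1 SAW item), the five Theses files of the sub and the 110
Ideas cards by title; plus the card author's
searches (crossref ×2, grep of ~70 cards, lit frontier/bridges) and the novelty audit's (zbMATH ×3,
crossref ×2; OpenAlex/S2 429).
Nearest prior art found: KadanoffCeva1971 (doi:10.1103/physrevb.3.3918: defect lines whose cut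
surface is a gauge choice = exact symmetry-flux
insertions, the ℤ₂ template of surface independence); BilloEtAl2013 (arXiv:1304.4110: the ℤ₂
monodromy line defect in 3D Ising);
doi:10.1103/physrevx.8.011040 (Thorngren–Else: dislocations/disclinations as fluxes of crystalline
gauge fields); doi:10.1103/physrevb.88.195412
(Tu–Zhang–Qi momentum polarization: half-system twist = momentum flux through the cut);
doi:10.1016/0550-3213(88)90332-x (CCMP lattice EMT from
coupling deformations, perturbative); DKKMO2020Rotational (rotation invariance  [refs: 10.1080/00018739300101544, 10.1103/physrevb.3.3918:, 10.1103/physrevx.8.011040, 10.1103/physrevb.88.195412, 10.1016/0550-3213(88, 1304.4110, doi:10.1080/00018739300101544, doi:10.1103/physrevb.3.3918, doi:10.1103/physrevx.8.011040, doi:10.1103/physrevb.88.195412, doi:10.1016/0550-3213, CaiNix2016, KadanoffCeva1971, BilloEtAl2013]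

Barriers (technique_class: stress-flux-by-lattice-surgery): - technique_class: stress-flux-by-lattice-surgery
- Literature.Barriers.CriticalPhenomena.ScaleCovarianceNotMoebius: not engaged by the new cruxes
(they deliver rotations only); the inversion is the shared item InversionUpgradeNormalised, typed
with the NonCoincident normalisation that Theorems/IsingEuclidUpgradeRefutations.lean prescribes,
and the barrier's witness is already O(3)-invariant.
- Literature.Barriers.CriticalPhenomena.LiouvilleRigidity: respected — clean (matter-conserving)
surgeries realise only isometries; a dilation or special-conformal monodromy would need climb
(inserted/deleted matter of macroscopic area, a relevant planar defect since Δ_ε < 2): Liouville's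
rigidity seen from the crystal (card V5); no conformal maps, discrete holomorphicity or Virasoro
enter.
- Literature.Barriers.CriticalPhenomena.BootstrapLatticeBlindness: evaded — every new statement is
about the n.n. model on explicit finite graphs (PairIsing.avg on twisted boxes); no CFT data are
assumed.
- Literature.Barriers.CriticalPhenomena.IsingTrivialityFromDimensionFour: not engaged (clause (iii)
is the shared item 0636); consistent with it: CoreTransparency needs Δ_ε > d − 2, true for n.n. d =
3 (1.41 > 1) and marginal-false for d ≥ 4 (Δ_ε = d − 2), so the engine is d-specific as it must be.
- Literature.Barriers.CriticalPhenomena.LongRangeTrivialityOnZ3: not met — long-range couplings are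
metric data, not graph data; there is no Volterra surgery of a long-range model, so the engine does
not t

History (route lifecycle, newest last):
- 2026-08-15T16:53:40Z · rev 2: restated TwistFluxConservation (stmt-CriticalPhenomena-7037), CoreTransparency (stmt-CriticalPhenomena-7038), WallCrossingContinuity (stmt-CriticalPhenomena-7039), WallDecay (stmt-CriticalPhenomena-7040) — cone repair (route-repair g2): dropped import Literature.Probability.LatticeModels.GaussianPairingBoundCoup (planner-rrepair-CriticalPhenomena-VolterraWard-38547771-g2-0)
- 2026-08-25T04:39:21Z · DORMANT — reconciler: no traction for 7.4 d (last activity item-evidence-added at 2026-08-17T19:00:39Z); parked, not closed — `ledger route dormant route-CriticalPhenomen (operator:999:3126388)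
- 2026-08-27T13:42:09Z · REACTIVATED — reconciler: reactivated — activity statement-claimed at 2026-08-27T11:07:20Z after parking at 2026-08-25T04:39:21Z (operator:999:4117348)
- 2026-08-29T19:34:16Z · DORMANT — census g0: costume|duplicate of route-CriticalPhenomena-HyperoctahedralRP; reader census-reader-36-g0 (operator:999:1277276)

sub-problem: Ising3DConformalLimit · status: dormant · opened planner-plancard-CriticalPhenomena-Ising3DCon-5652c325-0 2026-08-15T12:00:33Z · rev 2 · ledger route-CriticalPhenomena-VolterraWard
GENERATED by the gate from the ledger (D-0016/17). Provers cite these decls: `theorem foo : Summit.CriticalPhenomena.Ising3DConformalLimit.Theses.VolterraWard.<Decl> := …` in Summits/CriticalPhenomena/Ising3DConformalLimit/Theorems/<Name>.lean.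
-/

namespace Summit.CriticalPhenomena.Ising3DConformalLimit.Theses.VolterraWard

open scoped BigOperators Topology Manifold Classical MeasureTheory ProbabilityTheory Matrix InnerProductSpace ComplexConjugate ContinuousMap
open Filter Set Function TopologicalSpace MeasureTheory

attribute [summit_statement] _root_.Ising3DConformalLimit

-- earlier TwistFluxConservation (stmt-CriticalPhenomena-7037, replaced 2026-08-15T16:53:40Z -> stmt-CriticalPhenomena-11222): retired by None — open Literature.Probability.LatticeModels in (let F : ℕ → ℤ → Site 3 → Site 3 := fun W M p i => if i = 0 then p 0 - M * (p 1 / (W : ℤ)) else if i = 1 then p 1 + M * ((p 0 - M * (p 1 / (W : ℤ))) / (W : ℤ)) else p 2; let C : (N W : ℕ) → (M A : ℤ) → (n : ℕ) → (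
/-- item stmt-CriticalPhenomena-11222 · crux · rank 2 · open · by planner
why it might fail: This IS emergent isotropy: an O_h-symmetric but anisotropic subsequential limit (relevant/marginal spin-4 cubic operator; physics puts it at Δ≈5.02, irrelevant, nothing rigorous) transmits torque through empty slabs; also dies if fat-screw achiral remnants are only marginal (ν=1/2).
sources: CaiNix2016, KadanoffCeva1971, doi:10.1016/0550-3213(88)90332-x, DuminilCopinICM2022, DKKMO2020Rotational, BilloEtAl2013
[crux] (INV, card V3 in single-wall form) For every n, every compact K of non-coincident
configurations, every insertion-free closed height slab [a, a′] for K and every η > 0: for w small,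
then ε small, then δ small, then N large, uniformly in x ∈ K, the ε-odd twisted free-box response D
(twist M minus twist −M, M = ⌊ε⌊w/δ⌋⌋, block ⌊w/δ⌋, free b.c. on box 3 N at β_c(3)) with the wall at
⌊a/δ⌋ differs from the one with the wall at ⌊a′/δ⌋ by at most η·ε·⟨∏σ_[xᵢ/δ]⟩⁺_(β_c). The twisted
graph: planar n.n. bonds in layers z ≤ A, F-pulled-back planar bonds in layers z > A, straight
vertical bonds (≅ the card's bicrystal glued by F). Finite-volume state (cone repair 2026-08-15):
the tree's `isingExpect` (Literature/Probability/LatticeModels/IsingModel.lean) of the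
nearest-neighbour Ising model on the twisted SimpleGraph of ↥(box 3 N) (`SimpleGraph.fromRel` of the
bond predicate; uniform coupling, β = criticalBeta 3, h = 0, free b.c., Λ = univ) — the same Gibbs
average as the former `PairIsing.avg` spelling with ordered-pair couplings β_c/2 (the bond predicate
is symmetric and irreflexive), so the statement is unchanged in meaning; the Theses file now needs
no import outside the summit bas -/
@[route_item "route-CriticalPhenomena-VolterraWard", crux]
def TwistFluxConservation : Prop :=
  open Literature.Probability.LatticeModels in (let F : ℕ → ℤ → Site 3 → Site 3 := fun W M p i => if i = 0 then p 0 - M * (p 1 / (W : ℤ)) else if i = 1 then p 1 + M * ((p 0 - M * (p 1 / (W : ℤ))) / (W : ℤ)) else p 2; let C : (N W : ℕ) → (M A : ℤ) → (n : ℕ) → (Fin n → Site 3) → ℝ := fun N W M A _n y => isingExpect (SimpleGraph.fromRel fun a b : ↥(box 3 N) => (a.1 2 = b.1 2 ∧ a.1 2 ≤ A ∧ |a.1 0 - b.1 0| + |a.1 1 - b.1 1| = 1) ∨ (a.1 2 = b.1 2 ∧ A < a.1 2 ∧ |F W M a.1 0 - F W M b.1 0| + |F W M a.1 1 - F W M b.1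 1| = 1) ∨ (a.1 0 = b.1 0 ∧ a.1 1 = b.1 1 ∧ |a.1 2 - b.1 2| = 1)) Finset.univ (criticalBeta 3) 0 BoundaryCondition.free (fun s => ∏ i, if h : y i ∈ box 3 N then spinAt (⟨y i, h⟩ : ↥(box 3 N)) s else 0); let D : (N W : ℕ) → (M A : ℤ) → (n : ℕ) → (Fin n → Site 3) → ℝ := fun N W M A n y => C N W M A n y - C N W (-M) A n y; ∀ (n : ℕ) (K : Set (Fin n → EuclideanSpace ℝ (Fin 3))), K ⊆ NonCoincident 3 n → IsCompact K → ∀ (a a' η : ℝ), a ≤ a' → (∀ x ∈ K, ∀ i, x i 2 < a ∨ a' < x i 2) → 0 < η → ∃ w₀ > (0 : ℝ), ∀ w ∈ Set.Ioo 0 w₀, ∃ ε₀ > (0 : ℝ), ∀ ε ∈ Set.Ioo 0 ε₀, ∃ δ₀ > (0 : ℝ), ∀ δ ∈ Set.Ioo 0 δ₀, ∃ N₀ : ℕ, ∀ N ≥ N₀, ∀ x ∈ K, |D N ⌊w / δ⌋₊ ⌊ε * ⌊w / δ⌋₊⌋ ⌊a / δ⌋ n (fun i => latticeApprox δ (x i))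 - D N ⌊w / δ⌋₊ ⌊ε * ⌊w / δ⌋₊⌋ ⌊a' / δ⌋ n (fun i => latticeApprox δ (x i))| ≤ η * ε * criticalCorr 3 n (fun i => latticeApprox δ (x i)))

-- earlier CoreTransparency (stmt-CriticalPhenomena-7038, replaced 2026-08-15T16:53:40Z -> stmt-CriticalPhenomena-11223): retired by None — open Literature.Probability.LatticeModels in (let F : ℕ → ℤ → Site 3 → Site 3 := fun W M p i => if i = 0 then p 0 - M * (p 1 / (W : ℤ)) else if i = 1 then p 1 + M * ((p 0 - M * (p 1 / (W : ℤ))) / (W : ℤ)) else p 2; let C : (N W : ℕ) → (M A : ℤ) → (n : ℕ) → (Fin n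
/-- item stmt-CriticalPhenomena-11223 · crux · rank 3 · open · by planner
why it might fail: Needs STRICT irrelevance of even line defects, Δ_ε>1 ⇔ ν>1/2 strictly (physics Δ_ε=1.4126; rigorously only ν≥1/2): a fat screw (Burgers M=εw/δ→∞) is a strong universal-cover line defect out to radius b=εw and the wall carries 2/w of them per unit length.
sources: doi:10.1080/00018739300101544, KosPolandSimmonsDuffinVichi2016, FernandezFrohlichSokal1992, BilloEtAl2013, DuminilcopinPanis2025, CaiNix2016
[crux] (CORE, the audit's worry isolated; card V2 corrected from (δ/r)^p to (b/r)^p) Zeroth-order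
transparency of the twist wall as the Burgers LENGTH b = εw → 0 at FIXED block size w: for every n,
compact K, wall height a avoiding the insertion heights of K, every w > 0 and η > 0: for ε small,
then δ small, then N large, uniformly on K, |C(M) + C(−M) − 2⟨∏σ⟩⁺_(β_c)| ≤ η⟨∏σ⟩⁺_(β_c) (the ε-even
combination of twisted free-box correlators tends to twice the plain infinite-volume critical
correlator). Equivalent in RG language to strict irrelevance of the achiral remnant of a fat screw,
i.e. Δ_ε > 1. Necessary for INV/KIN/DECAY as stated; not consumed by the assembly term (diagnostic
input crux, listed first in the Assembly). Finite-volume state (cone repair 2026-08-15): the tree's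
`isingExpect` (Literature/Probability/LatticeModels/IsingModel.lean) of the nearest-neighbour Ising
model on the twisted SimpleGraph of ↥(box 3 N) (`SimpleGraph.fromRel` of the bond predicate; uniform
coupling, β = criticalBeta 3, h = 0, free b.c., Λ = univ) — the same Gibbs average as the former
`PairIsing.avg` spelling with ordered-pair couplings β_c/2 (the bond predicate is symmetric and
irreflexive), so -/
@[route_item "route-CriticalPhenomena-VolterraWard", crux]
def CoreTransparency : Prop :=
  open Literature.Probability.LatticeModels in (let F : ℕ → ℤ → Site 3 → Site 3 := fun W M p i => if i = 0 then p 0 - M * (p 1 / (W : ℤ)) else if i = 1 then p 1 + M * ((p 0 - M * (p 1 / (W : ℤ))) / (W : ℤ)) else p 2; let C : (N W : ℕ) → (M A : ℤ) → (n : ℕ) → (Fin n → Site 3) → ℝ := fun N W M A _n y => isingExpect (SimpleGraph.fromRel fun a b : ↥(box 3 N) => (a.1 2 = b.1 2 ∧ a.1 2 ≤ A ∧ |a.1 0 - b.1 0| + |a.1 1 - b.1 1| = 1) ∨ (a.1 2 = b.1 2 ∧ A < a.1 2 ∧ |F W M a.1 0 - F W M b.1 0| + |F W M a.1 1 - F W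 M b.1 1| = 1) ∨ (a.1 0 = b.1 0 ∧ a.1 1 = b.1 1 ∧ |a.1 2 - b.1 2| = 1)) Finset.univ (criticalBeta 3) 0 BoundaryCondition.free (fun s => ∏ i, if h : y i ∈ box 3 N then spinAt (⟨y i, h⟩ : ↥(box 3 N)) s else 0); ∀ (n : ℕ) (K : Set (Fin n → EuclideanSpace ℝ (Fin 3))), K ⊆ NonCoincident 3 n → IsCompact K → ∀ (a w η : ℝ), (∀ x ∈ K, ∀ i, x i 2 ≠ a) → 0 < w → 0 < η → ∃ ε₀ > (0 : ℝ), ∀ ε ∈ Set.Ioo 0 ε₀, ∃ δ₀ > (0 : ℝ), ∀ δ ∈ Set.Ioo 0 δ₀, ∃ N₀ : ℕ, ∀ N ≥ N₀, ∀ x ∈ K, |C N ⌊w / δ⌋₊ ⌊ε * ⌊w / δ⌋₊⌋ ⌊a / δ⌋ n (fun i => latticeApprox δ (x i)) + C N ⌊w / δ⌋₊ (-⌊ε * ⌊w / δ⌋₊⌋) ⌊a / δ⌋ n (fun i => latticeApprox δ (x i)) - 2 * criticalCorr 3 n (fun i => latticeApprox δ (x i))| ≤ η * criticalCorr 3 n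 (fun i => latticeApprox δ (x i)))

-- earlier WallCrossingContinuity (stmt-CriticalPhenomena-7039, replaced 2026-08-15T16:53:40Z -> stmt-CriticalPhenomena-11224): retired by None — open Literature.Probability.LatticeModels in (let F : ℕ → ℤ → Site 3 → Site 3 := fun W M p i => if i = 0 then p 0 - M * (p 1 / (W : ℤ)) else if i = 1 then p 1 + M * ((p 0 - M * (p 1 / (W : ℤ))) / (W : ℤ)) else p 2; let C : (N W : ℕ) → (M A : ℤ) → (n : ℕ) → 
/-- item stmt-CriticalPhenomena-11224 · crux · rank 4 · open · by planner
why it might fail: The wall's contact term at an insertion must vanish: this uses an OPE-like local structure in which the plane integral of T_[xy]·σ starts at ∂x∂yσ (odd under both in-plane mirrors); a lattice-scale wall–spin anomaly at height distance h≫w≫b could survive the limits.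
sources: Cardy1996, doi:10.1016/0550-3213(88)90332-x, PolandRychkovVichi2019, KadanoffCeva1971, KosPolandSimmonsDuffinVichi2016
[crux] (KIN, card V4 in the relabelled convention where insertions keep their physical positions)
For every n, compact K, height t and η > 0 there is h₀ such that for every h < h₀: for w small, then
ε small, then δ small, then N large, uniformly on K, the ε-odd responses with the wall at ⌊(t+h)/δ⌋
and at ⌊(t−h)/δ⌋ differ by at most η·ε·⟨∏σ⟩⁺_(β_c): crossing an insertion height produces no O(ε)
jump (the wall's contact term is purely kinematic and, in this convention, absent). h → 0 is the
OUTERMOST limit (h chosen before w). Finite-volume state (cone repair 2026-08-15): the tree's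
`isingExpect` (Literature/Probability/LatticeModels/IsingModel.lean) of the nearest-neighbour Ising
model on the twisted SimpleGraph of ↥(box 3 N) (`SimpleGraph.fromRel` of the bond predicate; uniform
coupling, β = criticalBeta 3, h = 0, free b.c., Λ = univ) — the same Gibbs average as the former
`PairIsing.avg` spelling with ordered-pair couplings β_c/2 (the bond predicate is symmetric and
irreflexive), so the statement is unchanged in meaning; the Theses file now needs no import outside
the summit base cone. [deps: CoreTransparency] [difficulty: XL] -/
@[route_item "route-CriticalPhenomena-VolterraWard", crux]
def WallCrossingContinuity : Prop :=
  open Literature.Probability.LatticeModels in (let F : ℕ → ℤ → Site 3 → Site 3 := fun W M p i => if i = 0 then p 0 - M * (p 1 / (W : ℤ)) else if i = 1 then p 1 + M * ((p 0 - M * (p 1 / (W : ℤ))) / (W : ℤ)) else p 2; let C : (N W : ℕ) → (M A : ℤ) → (n : ℕ) → (Fin n → Site 3) → ℝ := fun N W M A _n y => isingExpect (SimpleGraph.fromRel fun a b : ↥(box 3 N) => (a.1 2 = b.1 2 ∧ a.1 2 ≤ A ∧ |a.1 0 - b.1 0| + |a.1 1 - b.1 1| = 1) ∨ (a.1 2 =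 b.1 2 ∧ A < a.1 2 ∧ |F W M a.1 0 - F W M b.1 0| + |F W M a.1 1 - F W M b.1 1| = 1) ∨ (a.1 0 = b.1 0 ∧ a.1 1 = b.1 1 ∧ |a.1 2 - b.1 2| = 1)) Finset.univ (criticalBeta 3) 0 BoundaryCondition.free (fun s => ∏ i, if h : y i ∈ box 3 N then spinAt (⟨y i, h⟩ : ↥(box 3 N)) s else 0); let D : (N W : ℕ) → (M A : ℤ) → (n : ℕ) → (Fin n → Site 3) → ℝ := fun N W M A n y => C N W M A n y - C N W (-M) A n y; ∀ (n : ℕ) (K : Set (Fin n → EuclideanSpace ℝ (Fin 3))), K ⊆ NonCoincident 3 n → IsCompact K → ∀ (t η : ℝ), 0 < η → ∃ h₀ > (0 : ℝ), ∀ h ∈ Set.Ioo 0 h₀, ∃ w₀ > (0 : ℝ), ∀ w ∈ Set.Ioo 0 w₀, ∃ ε₀ > (0 : ℝ), ∀ ε ∈ Set.Ioo 0 ε₀, ∃ δ₀ > (0 : ℝ), ∀ δ ∈ Set.Ioo 0 δ₀, ∃ N₀ : ℕ, ∀ N ≥ N₀, ∀ x ∈ K, |D N ⌊w / δ⌋₊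 ⌊ε * ⌊w / δ⌋₊⌋ ⌊(t + h) / δ⌋ n (fun i => latticeApprox δ (x i)) - D N ⌊w / δ⌋₊ ⌊ε * ⌊w / δ⌋₊⌋ ⌊(t - h) / δ⌋ n (fun i => latticeApprox δ (x i))| ≤ η * ε * criticalCorr 3 n (fun i => latticeApprox δ (x i)))

-- earlier WallDecay (stmt-CriticalPhenomena-7040, replaced 2026-08-15T16:53:40Z -> stmt-CriticalPhenomena-11225): retired by None — open Literature.Probability.LatticeModels in (let F : ℕ → ℤ → Site 3 → Site 3 := fun W M p i => if i = 0 then p 0 - M * (p 1 / (W : ℤ)) else if i = 1 then p 1 + M * ((p 0 - M * (p 1 / (W : ℤ))) / (W : ℤ)) else p 2; let C : (N W : ℕ) → (M A : ℤ) → (n : ℕ) → (Fin n → Site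
/-- item stmt-CriticalPhenomena-11225 · crux · rank 5 · open · by planner
why it might fail: (−) is exact transport by the graph isomorphism F×id plus decay of the far wall's O(ε) torque; both parts fail if the ε-odd influence of a wall at distance |a| does not vanish as |a|→∞ after ε→0 (long-range chiral memory), or if free-box limits on twisted graphs misbehave at β_c.
sources: GeorgiiHiguchi2000, FriedliVelenik2017, AizenmanDuminilCopinSidoravicius2015, Raoufi2020, CaiNix2016
[crux] (DECAY, card V4 'cluster property' half, made precise) Conjunction of: (+) for every n,
compact K, η > 0 there is a₀ with: for every wall height a ≥ a₀, for w small, then ε small, then δ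
small, then N large, uniformly on K, |D(⌊a/δ⌋)| ≤ η ε ⟨∏σ⟩⁺_(β_c) (a wall far ABOVE everything is
invisible at O(ε)); (−) the same with a ≤ a₀ (far BELOW everything) for |D(⌊a/δ⌋) −
(⟨∏σ_(F_M[xᵢ/δ])⟩⁺_(β_c) − ⟨∏σ_(F_(−M)[xᵢ/δ])⟩⁺_(β_c))|: up to o(ε) the wall acts as the EXACT
TRANSPORT of the insertions by the brickwork map (graph isomorphism F×id of the pulled-back region
onto ℤ³), the kinematic term, expressed with infinite-volume critical correlators at the transported
sites. Finite-volume state (cone repair 2026-08-15): the tree's `isingExpect`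
(Literature/Probability/LatticeModels/IsingModel.lean) of the nearest-neighbour Ising model on the
twisted SimpleGraph of ↥(box 3 N) (`SimpleGraph.fromRel` of the bond predicate; uniform coupling, β
= criticalBeta 3, h = 0, free b.c., Λ = univ) — the same Gibbs average as the former `PairIsing.avg`
spelling with ordered-pair couplings β_c/2 (the bond predicate is symmetric and irreflexive), so the
statement is unchanged in meaning; the Theses file -/
@[route_item "route-CriticalPhenomena-VolterraWard", crux]
def WallDecay : Prop :=
  open Literature.Probability.LatticeModels in (let F : ℕ → ℤ → Site 3 → Site 3 := fun W M p i => if i = 0 then p 0 - M * (p 1 / (W : ℤ)) else if i = 1 then p 1 + M * ((p 0 - M * (p 1 / (W : ℤ))) / (W : ℤ)) else p 2; let C : (N W : ℕ) → (M A : ℤ) → (n : ℕ) → (Fin n → Site 3) → ℝ := fun N W M A _n y => isingExpect (SimpleGraph.fromRel fun a b : ↥(box 3 N) => (a.1 2 = b.1 2 ∧ a.1 2 ≤ A ∧ |a.1 0 - b.1 0| + |a.1 1 - b.1 1| = 1) ∨ (a.1 2 = b.1 2 ∧ A < a.1 2 ∧ |F W M a.1 0 - F W M b.1 0| + |F W M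 a.1 1 - F W M b.1 1| = 1) ∨ (a.1 0 = b.1 0 ∧ a.1 1 = b.1 1 ∧ |a.1 2 - b.1 2| = 1)) Finset.univ (criticalBeta 3) 0 BoundaryCondition.free (fun s => ∏ i, if h : y i ∈ box 3 N then spinAt (⟨y i, h⟩ : ↥(box 3 N)) s else 0); let D : (N W : ℕ) → (M A : ℤ) → (n : ℕ) → (Fin n → Site 3) → ℝ := fun N W M A n y => C N W M A n y - C N W (-M) A n y; (∀ (n : ℕ) (K : Set (Fin n → EuclideanSpace ℝ (Fin 3))), K ⊆ NonCoincident 3 n → IsCompact K → ∀ η : ℝ, 0 < η → ∃ a₀ : ℝ, ∀ a ≥ a₀, ∃ w₀ > (0 : ℝ), ∀ w ∈ Set.Ioo 0 w₀, ∃ ε₀ > (0 : ℝ), ∀ ε ∈ Set.Ioo 0 ε₀, ∃ δ₀ > (0 : ℝ), ∀ δ ∈ Set.Ioo 0 δ₀, ∃ N₀ : ℕ, ∀ N ≥ N₀, ∀ x ∈ K, |D N ⌊w / δ⌋₊ ⌊ε * ⌊w / δ⌋₊⌋ ⌊a / δ⌋ n (fun i => latticeApprox δ (x i))| ≤ η *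 ε * criticalCorr 3 n (fun i => latticeApprox δ (x i))) ∧ (∀ (n : ℕ) (K : Set (Fin n → EuclideanSpace ℝ (Fin 3))), K ⊆ NonCoincident 3 n → IsCompact K → ∀ η : ℝ, 0 < η → ∃ a₀ : ℝ, ∀ a ≤ a₀, ∃ w₀ > (0 : ℝ), ∀ w ∈ Set.Ioo 0 w₀, ∃ ε₀ > (0 : ℝ), ∀ ε ∈ Set.Ioo 0 ε₀, ∃ δ₀ > (0 : ℝ), ∀ δ ∈ Set.Ioo 0 δ₀, ∃ N₀ : ℕ, ∀ N ≥ N₀, ∀ x ∈ K, |D N ⌊w / δ⌋₊ ⌊ε * ⌊w / δ⌋₊⌋ ⌊a / δ⌋ n (fun i => latticeApprox δ (x i)) - (criticalCorr 3 n (fun i => F ⌊w / δ⌋₊ ⌊ε * ⌊w / δ⌋₊⌋ (latticeApprox δ (x i))) - criticalCorr 3 n (fun i => F ⌊w / δ⌋₊ (-⌊ε * ⌊w / δ⌋₊⌋) (latticeApprox δ (x i))))| ≤ η * ε * criticalCorr 3 n (fun i => latticeApprox δ (x i))))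

/-- item stmt-CriticalPhenomena-1981 · crux · rank 6 · open · by planner
why it might fail: Full δ→0⁺ convergence with ONE continuous Δ is open on ℤ³: only subsequential limits follow from the two-point bounds, and RP/GKS two-point axiomatics admit log-periodic (discretely scale covariant) profiles (card rp-cannot-fix-the-scale-log-periodic).
sources: DuminilCopinICM2022, DuminilcopinPanis2025, arXiv:1912.07973, AizenmanDuminilCopinAnnals2021
[crux r4, (C), existence WITHOUT rotations] There are ρ > 0 on (0,1], Δ > 0 and S with
HasPointwiseScalingLimit (criticalCorr 3) ρ S, S = 0 off NonCoincident, IsNondegenerateTwoPoint S,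
IsTranslationInvariant S, IsScaleCovariant Δ S. Strictly weaker than CritIsing3DEuclideanLimit (item
0638: rotations included) — on this route isotropy is OUTPUT. Inputs in tree:
criticalTwoPoint_bounds_holds (c|x|⁻² ≤ G ≤ C|x|⁻¹ ⇒ subsequential limits, Δ ∈ [1/2,1]); missing:
uniqueness/full-filter convergence and continuous scale covariance (DuminilCopinICM2022 §8.4 p.29:
'widely open'). -/
@[route_item "route-CriticalPhenomena-VolterraWard", crux]
def ExistsScaleCovariantLimit : Prop :=
  ∃ (ρ : ℝ → ℝ) (Δ : ℝ) (S : Literature.Probability.LatticeModels.CorrFamily 3), (∀ δ ∈ Set.Ioc (0:ℝ) 1, 0 < ρ δ) ∧ 0 < Δ ∧ Literature.Probability.LatticeModels.HasPointwiseScalingLimit (Literature.Probability.LatticeModels.criticalCorr 3) ρ S ∧ (∀ n z, z ∉ Literature.Probability.LatticeModels.NonCoincident 3 n → S n z = 0) ∧ Literature.Probability.LatticeModels.IsNondegenerateTwoPoint S ∧ Literature.Probability.LatticeModels.IsTranslationInvariant S ∧ Literature.Probability.LatticeModels.IsScaleCovariant Δ S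

/-- item stmt-CriticalPhenomena-1982 · crux · rank 7 · open · by planner
why it might fail: Scale + RP + Euclid ⇏ Möbius in general (free Maxwell d=3; RP descendant witnesses at Δ=7/2); for Ising it fails if the limit carries a virial current of dimension exactly 2 or lacks a local stress tensor — excluded only by Monte-Carlo (Δ_V > 5).
sources: ElshowkNakayamaRychkov2011, Nakayama2015, DelamotteTissierWschebor2016, PolandRychkovVichi2019, DuminilCopinICM2022
[crux r5, (D), inversion upgrade re-typed] Every pointwise scaling limit S of criticalCorr 3 (ρ > 0
on (0,1]) that is normalised (S = 0 off NonCoincident), non-degenerate, Euclidean invariant and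
scale covariant with Δ is IsInversionCovariant Δ (hence Möbius). This is (U) of route
IsingEuclidUpgrade (item 0637, refuted AS TYPED by not_inversionUpgrade_of_euclideanLimit through
values on the coincident locus) with the normalisation hypothesis the refutation file prescribes;
the model-blind version is false (Literature.Barriers.CriticalPhenomena.ScaleCovarianceNotMoebius;
free Maxwell d=3, ElshowkNakayamaRychkov2011), so any proof must use the Ising hypothesis (RP +
locality / absence of a dimension-2 virial current: DelamotteTissierWschebor2016 §5–6,
Nakayama2015). -/
@[route_item "route-CriticalPhenomena-VolterraWard", crux]
def InversionUpgradeNormalised : Prop :=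
  ∀ (ρ : ℝ → ℝ) (Δ : ℝ) (S : Literature.Probability.LatticeModels.CorrFamily 3), (∀ δ ∈ Set.Ioc (0:ℝ) 1, 0 < ρ δ) → Literature.Probability.LatticeModels.HasPointwiseScalingLimit (Literature.Probability.LatticeModels.criticalCorr 3) ρ S → (∀ n z, z ∉ Literature.Probability.LatticeModels.NonCoincident 3 n → S n z = 0) → Literature.Probability.LatticeModels.IsNondegenerateTwoPoint S → Literature.Probability.LatticeModels.IsEuclideanInvariant S → Literature.Probability.LatticeModels.IsScaleCovariant Δ S → Literature.Probability.LatticeModels.IsInversionCovariant Δ S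

/-- item stmt-CriticalPhenomena-0636 · crux · rank 8 · open · by planner
why it might fail: No proof that U₄ ≢ 0 in d = 3: the double-current intersection probability at macroscopic separation must stay > 0 as δ → 0; RP long-range models ON ℤ³ (α < 3/2) are Gaussian (LongRangeTrivialityOnZ3).
sources: AizenmanDuminilCopinAnnals2021, DuminilCopinICM2022
Crux r4 (non-triviality in d=3): every non-degenerate pointwise scaling limit S of the renormalised
critical Ising correlators on Z^3 has connected four-point function U4 ≢ 0 on non-coincident
configurations. Intended tool: the random-current identity U4(x,y,z,t) =
−2⟨σxσy⟩⟨σzσt⟩·P^{xy,zt}[C_{n1+n2}(x) ∩ C_{n1+n2}(z) ≠ ∅] (Aizenman 1982; ADC2021 arXiv:1912.07973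
eq. (3.11)): non-Gaussianity ⇔ the intersection probability of the two double-current clusters at
macroscopic separation does not vanish as δ → 0. Contrast: for d ≥ 4 every such limit IS Gaussian
(Literature.Probability.LatticeModels.highDim_triviality). Its negation refutes the conjunct
Ising3DConformalLimit itself. -/
@[route_item "route-CriticalPhenomena-VolterraWard", crux]
def IsingEuclidUpgradeR4NonGaussian : Prop :=
  ∀ (ρ : ℝ → ℝ) (S : Literature.Probability.LatticeModels.CorrFamily 3), (∀ δ ∈ Set.Ioc (0:ℝ) 1, 0 < ρ δ) → Literature.Probability.LatticeModels.HasPointwiseScalingLimit (Literature.Probability.LatticeModels.criticalCorr 3) ρ S → Literature.Probability.LatticeModels.IsNondegenerateTwoPoint S → Literature.Probability.LatticeModels.HasNontrivialU4 S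

/-- item stmt-CriticalPhenomena-7041 · support · rank 9 · open · by planner
sources: DuminilCopinICM2022, CaiNix2016, Thomson 1994 Symmetric Properties of Real Functions (Dekker) ch. 1–2
[support] (GLUE, real analysis + the scaling limit; card V4 'Lean-sized' part, made honest)
TwistFluxConservation → WallCrossingContinuity → WallDecay → for every ρ > 0 on (0,1] and every
pointwise scaling limit S of criticalCorr 3 that is normalised (S = 0 off NonCoincident) and
continuous on NonCoincident: S is invariant under every linear isometry fixing e₃ =
EuclideanSpace.single 2 1 with determinant 1 (rotations about the lattice axis along which the wall
construction is stacked). Proof plan: telescoping over wall heights (finitely many INV gaps + KIN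
crossings, DECAY at both ends, common thresholds since all four statements nest w, ε, δ, N
identically) ⇒ |⟨∏σ_(F_M y)⟩ − ⟨∏σ_(F_(−M) y)⟩| ≤ Cηε⟨∏σ_y⟩ uniformly on K; the EXACT identity F_M ∘
[·/δ] = [·/δ] ∘ F_cont (F_cont(v) = v + Mδ(−k, j, 0), k = ⌊v₁/(Wδ)⌋, j = ⌊(v₀ − Mδk)/(Wδ)⌋, floor
identity ⌊⌊t⌋/W⌋ = ⌊t/W⌋) turns this into symmetric differences of S along the piecewise-constant
field u_w(v) = w(−⌊v₁/w⌋, ⌊v₀/w⌋, 0) = e₃×v + O(w); a leapfrog chain of ε-steps (discrete Euler flow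
of u_w), then ε → 0, w → 0 and continuity of S give S(R_θ x) = S(x) ('upper symmetric derivate ≤ κ
everywhere + continuity ⇒ κ-Lipschitz along the f -/
@[route_item "route-CriticalPhenomena-VolterraWard", crux]
def VolterraGlue : Prop :=
  TwistFluxConservation → WallCrossingContinuity → WallDecay → ∀ (ρ : ℝ → ℝ) (S : Literature.Probability.LatticeModels.CorrFamily 3), (∀ δ ∈ Set.Ioc (0:ℝ) 1, 0 < ρ δ) → Literature.Probability.LatticeModels.HasPointwiseScalingLimit (Literature.Probability.LatticeModels.criticalCorr 3) ρ S → (∀ n z, z ∉ Literature.Probability.LatticeModels.NonCoincident 3 n → S n z = 0) → (∀ n, ContinuousOn (S n) (Literature.Probability.LatticeModels.NonCoincident 3 n)) → ∀ (R : EuclideanSpace ℝ (Fin 3) ≃ₗᵢ[ℝ] EuclideanSpace ℝ (Fin 3)), R (EuclideanSpace.single 2 1) = EuclideanSpace.single 2 1 → LinearMap.det (R.toLinearEquiv : EuclideanSpace ℝ (Fin 3) →ₗ[ℝ] EuclideanSpace ℝ (Fin 3)) = 1 → ∀ (n : ℕ) (x : Fin n → EuclideanSpace ℝ (Fin 3)),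 S n (fun i => R (x i)) = S n x

/-- item stmt-CriticalPhenomena-7042 · support · rank 9 · open · by planner
sources: GeorgiiHiguchi2000, FriedliVelenik2017
[support] for every ρ > 0 on (0,1] and every normalised pointwise scaling limit S of criticalCorr 3
continuous on NonCoincident: invariance under the rotations about e₃ (isometries fixing
EuclideanSpace.single 2 1 with det 1) implies IsRotationInvariant S. Plan: the plus state at β_c is
invariant under the hyperoctahedral group B₃ of signed coordinate permutations (automorphism
covariance of the Ising specification + box limits, in tree: IsingAutomorphismCovariance /
GeorgiiHiguchi2000) and continuity absorbs the floor-rounding [x/δ] asymmetry, so S is B₃-invariant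
on NonCoincident (and 0 elsewhere); B₃ conjugates the e₃-stabiliser to the e₁-, e₂-stabilisers,
rotations about three axes generate SO(3) (Euler angles) and −1 ∈ B₃ gives O(3). [difficulty: M] -/
@[route_item "route-CriticalPhenomena-VolterraWard", crux]
def AxialRotationToO3 : Prop :=
  ∀ (ρ : ℝ → ℝ) (S : Literature.Probability.LatticeModels.CorrFamily 3), (∀ δ ∈ Set.Ioc (0:ℝ) 1, 0 < ρ δ) → Literature.Probability.LatticeModels.HasPointwiseScalingLimit (Literature.Probability.LatticeModels.criticalCorr 3) ρ S → (∀ n z, z ∉ Literature.Probability.LatticeModels.NonCoincident 3 n → S n z = 0) → (∀ n, ContinuousOn (S n) (Literature.Probability.LatticeModels.NonCoincident 3 n)) → (∀ (R : EuclideanSpace ℝ (Fin 3) ≃ₗᵢ[ℝ] EuclideanSpace ℝ (Fin 3)), R (EuclideanSpace.single 2 1) = EuclideanSpace.single 2 1 → LinearMap.det (R.toLinearEquiv : EuclideanSpace ℝ (Fin 3) →ₗ[ℝ] EuclideanSpace ℝ (Fin 3)) = 1 → ∀ (n : ℕ) (x : Fin n → EuclideanSpace ℝ (Fin 3)), S n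 (fun i => R (x i)) = S n x) → Literature.Probability.LatticeModels.IsRotationInvariant S

/-- item stmt-CriticalPhenomena-7043 · support · rank 9 · open · by planner
sources: DuminilcopinPanis2025, arXiv:2404.05700, arXiv:1912.07973, MessagerMiracleSoleJSP1977
[support] (CONT) every translation-invariant, scale-covariant pointwise scaling limit S of
criticalCorr 3 (ρ > 0 on (0,1]) has every S n continuous on NonCoincident 3 n. Engines: the
axis-direction spectral representation / gradient estimate for the critical two-point function
(DuminilcopinPanis2025, arXiv:2404.05700) and Messager–Miracle-Solé monotonicity give n = 2 (cf.
HyperoctahedralRP's TwoPointKernelOfLimit); n ≥ 3 via RP Cauchy–Schwarz transfer (card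
mirror-hoelder-modulus) or a lattice gradient estimate for n-point functions. Needed by
VolterraGlue/AxialRotationToO3 only through ContinuousOn. [difficulty: L] -/
@[route_item "route-CriticalPhenomena-VolterraWard", crux]
def LimitContinuous : Prop :=
  ∀ (ρ : ℝ → ℝ) (Δ : ℝ) (S : Literature.Probability.LatticeModels.CorrFamily 3), (∀ δ ∈ Set.Ioc (0:ℝ) 1, 0 < ρ δ) → Literature.Probability.LatticeModels.HasPointwiseScalingLimit (Literature.Probability.LatticeModels.criticalCorr 3) ρ S → Literature.Probability.LatticeModels.IsTranslationInvariant S → Literature.Probability.LatticeModels.IsScaleCovariant Δ S → ∀ n, ContinuousOn (S n) (Literature.Probability.LatticeModels.NonCoincident 3 n)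

/-- item stmt-CriticalPhenomena-7044 · assembly · rank 1 · open · by planner
sources: DuminilCopinICM2022, CaiNix2016
[assembly] CoreTransparency → TwistFluxConservation → WallCrossingContinuity → WallDecay →
VolterraGlue → AxialRotationToO3 → LimitContinuous → ExistsScaleCovariantLimit →
InversionUpgradeNormalised → IsingEuclidUpgradeR4NonGaussian → Ising3DConformalLimit -/
@[route_item "route-CriticalPhenomena-VolterraWard", crux]
def Assembly : Prop :=
  CoreTransparency → TwistFluxConservation → WallCrossingContinuity → WallDecay → VolterraGlue → AxialRotationToO3 → LimitContinuous → ExistsScaleCovariantLimit → InversionUpgradeNormalised → IsingEuclidUpgradeR4NonGaussian → Ising3DConformalLimit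

/-! D-0027 §2.1 — DECIDING THEOREM (planner-authored via `route open/edit --closes-file`; by operator:999:1754322 2026-08-15T15:02:42Z):
its hypotheses are this route's items and its conclusion the sub-problem Statement (glue_lint), and it elaborates with this file. -/

@[closes "route-CriticalPhenomena-VolterraWard"] theorem closes : TwistFluxConservation → CoreTransparency → WallCrossingContinuity → WallDecay → ExistsScaleCovariantLimit → InversionUpgradeNormalised → IsingEuclidUpgradeR4NonGaussian → VolterraGlue → AxialRotationToO3 → LimitContinuous → Assembly → _root_.Ising3DConformalLimit := fun h_TwistFluxConservation h_CoreTransparency h_WallCrossingContinuity h_WallDecay h_ExistsScaleCovariantLimit h_InversionUpgradeNormalised h_IsingEuclidUpgradeR4NonGaussian h_VolterraGlue h_AxialRotationToO3 h_LimitContinuous h_Assembly => h_Assembly h_CoreTransparency h_TwistFluxConservation h_WallCrossingContinuity h_WallDecay h_VolterraGlue h_AxialRotationToO3 h_LimitContinuous h_ExistsScaleCovariantLimit h_InversionUpgradeNormalised h_IsingEuclidUpgradeR4NonGaussian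

end Summit.CriticalPhenomena.Ising3DConformalLimit.Theses.VolterraWard
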